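import Summits.QuantumFields.YangMills.Theorems.BalabanUVNodesK2OwnNumbersDefs

/-! # CRIT-2 g3 kernel note `Crit2V0BlindProbe` — which conjuncts of K2⁷'s stub prefix are `v₀`-BLIND?

Context: plan g84's K2⁷ v7 DRAFT (β3) keys both stubs to `(datum).βfun k (fun _ => 0)` = `beta0OfMerged βm θ.v₀ k`
(`bOwn_eq_beta0OfMerged`, p610236); CRIT-2's repair R3 keys to the γ-base line instead; idea-7 g10 (V2) proposed a
TRANSPORT argument «typed-2ᴼᴰ[∀θ] ⟹ R3's statement» under the premise that the five-conjunct prefix is `v₀`-blind.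
This note records, for `θ' := {θ with v₀ := v'}` (`reV0`):

* KERNEL (`Iff.rfl` ∕ `rfl`, below): `ZhUnity`, `Admissible`, the merged family `βm` ARE `v₀`-blind; and the draft's own
  numbers of the R1-re-pinned tuple `reV0 θ γ⃗` ARE R3's γ-base-line numbers of `θ` (`bOwn_reV0_const_γ`).
* SOURCE-LEVEL (not a kernel failure certificate — recorded as prose): `Stage13Params.SlotsNondegenerate₁₃` (Record13.lean :487–491)
  and `Stage13HParams.Provisos₁₃SepCoPH` (Record13SepCoPH.lean :73ff) quantify over ALL `p : B12.RunParams` (`g0 : ℝ` UNCONSTRAINED,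
  B12.lean :72–75) and over `SeqOfRecord … (gOfRecord₁₃ F N θ.toStage13Params p) …`, where `gOfRecord₁₃ θ p = genSeq (betaOfRecord₁₃ θ) p.g0`
  (Record13.lean :188) and `genSeq β g0 (k+1)` reads `β k (prefix)` at the GENERATED prefix (FlowStepRuns.lean :379) — off the box
  `]0, θ.γ]^{k+1}` whenever `p.g0 ∉ ]0, θ.γ]` (or the run leaves the window), where `betaOfRecord₁₃ = betaOfMerged βm (beta0OfMerged βm θ.v₀) θ.γ`
  returns the `v₀`-FACE.  Hence these two prefix conjuncts are NOT `v₀`-blind as propositions (they speak about different generated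
  histories for `θ` and `θ'`), the transport premise fails for them, and the ∀θ statements «2ᴼᴰ keyed at `fun _ => 0`» and «2ᴼᴰ keyed
  at the γ-base line» are INCOMPARABLE in general — neither dominates by transport.  (Harmless for provability of the provisos
  themselves — generic measurability ∕ integrability along whatever histories — but fatal for transport arguments, and it retires
  CRIT-2's own repair R2 «add hv₀ + transport inside the skeleton»: only R3 (texts) + R1 (records) remain.)

HONEST FRAMING: definitional bookkeeping; nothing of Bałaban's is asserted or proved; no stub proved; K2⁷ OPEN; [B12] Thm 2 ∕ (0.31)
p.259 unproved in print; R4 closes ONLY the conditional finite-𝕋⁴ rung `BalabanLadder.UV`; the YM mass gap (Clay) is NOT proved. -/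

noncomputable section
open scoped Matrix.Norms.L2Operator
open Filter
open Literature.MathematicalPhysics.QuantumFieldTheory.Balaban1983to89
open Literature.MathematicalPhysics.QuantumFieldTheory.Balaban1983to89.FlowStep
open Literature.MathematicalPhysics.QuantumFieldTheory.Balaban1983to89.T4Continuum (T4Family)
open Summit.QuantumFields.YangMills.Theorems.BalabanUVNodesK2OwnNumbersDefs

set_option maxHeartbeats 800000

namespace Crit2V0Probe

variable (F : T4Family) (θ : Node00.Stage13HParams F 2) (v' : (k : ℕ) → (Fin (k + 1) → ℝ))

/-- the tuple with the base-history field replaced -/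
def reV0 : Node00.Stage13HParams F 2 := { θ with v₀ := v' }

theorem reV0_v₀ : (reV0 F θ v').v₀ = v' := rfl
theorem reV0_γ : (reV0 F θ v').γ = θ.γ := rfl
theorem reV0_ν : (reV0 F θ v').ν = θ.ν := rfl

/-- (1) partition of unity of the history-indexed residual: `v₀`-blind? -/
theorem zhUnity_reV0 : (reV0 F θ v').ZhUnity F 2 ↔ θ.ZhUnity F 2 := Iff.rfl

/-- (2) admissibility: `v₀`-blind? -/
theorem admissible_reV0 : (reV0 F θ v').Admissible F 2 ↔ θ.Admissible F 2 := Iff.rfl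

/-- (3) the merged β family (history → β) is `v₀`-blind (only ν, ε₂₉, εbg, ρ8, bV and the instances are read). -/
theorem betaMerged_reV0 :
    (letI := (reV0 F θ v').instVβ₁; letI := (reV0 F θ v').instVβ₂; letI := (reV0 F θ v').instιβ
      Node00.betaMerged F (Node00.mergedTermFamilyMatT F 2 (Node00.TcanOfRecord F 2)
        (Node00.chiFixed29 F 2 (reV0 F θ v').ν (reV0 F θ v').ε₂₉) (reV0 F θ v').εbg) (reV0 F θ v').ρ8 (reV0 F θ v').bV)
    = (letI := θ.instVβ₁; letI := θ.instVβ₂; letI := θ.instιβ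
      Node00.betaMerged F (Node00.mergedTermFamilyMatT F 2 (Node00.TcanOfRecord F 2)
        (Node00.chiFixed29 F 2 θ.ν θ.ε₂₉) θ.εbg) θ.ρ8 θ.bV) := rfl

/-- (4) R3's in-box base line: at `v' := fun k _ => θ.γ` the draft's own numbers of the RE-BASED tuple are the γ-base-line limits of the SAME merged β. -/
theorem bOwn_reV0_const_γ (k : ℕ) :
    bOwn F (reV0 F θ (fun _ _ => θ.γ)) k
      = (letI := θ.instVβ₁; letI := θ.instVβ₂; letI := θ.instιβ
          Node00.beta0OfMerged
            (Node00.betaMerged F (Node00.mergedTermFamilyMatT F 2 (Node00.TcanOfRecord F 2)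
              (Node00.chiFixed29 F 2 θ.ν θ.ε₂₉) θ.εbg) θ.ρ8 θ.bV) (fun _ _ => θ.γ) k) := by
  rw [bOwn_eq_beta0OfMerged]; rfl

end Crit2V0Probe
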